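import Summits.CriticalPhenomena.PercolationContinuityZ3.Theorems.SahiMasterFamilyUCCertSevenRD1
import Summits.CriticalPhenomena.PercolationContinuityZ3.Theorems.SahiMasterFamilyUCCertSevenRD2
import Summits.CriticalPhenomena.PercolationContinuityZ3.Theorems.SahiMasterFamilyUCCertSevenRD3

/-!
# F^UC(7) certificate check, part RD: the normal form of R = Q - 68740646591094191381791440*Phi_7 as the concatenation of its 3 slices

Unit `prim-masterthm-p4` (gen 16; crux anchor stmt-CriticalPhenomena-4575, helper work; memo P4-GEN16-REPORT.md §3/§11; certificate data for
`F^{UC}(7)`, generator `code-g16/gen_uccert.py` (mode splitn 3)).  Part of the orbit-basis check `PhiCert.fucNonneg_of_orbitPiecesU` (see `…UCCert`). [this work]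
-/
set_option autoImplicit false

namespace Summit.CriticalPhenomena.PercolationContinuityZ3.Theorems

namespace PhiCert

/-- The normal form `RD` of `R = Q − 68740646591094191381791440·Φ_7` (6535 monomials), as the concatenation of its slices. [this work] -/
def ucRD_seven : Poly :=
  ucRD_seven_1 ++ (ucRD_seven_2 ++ (ucRD_seven_3))

end PhiCert

end Summit.CriticalPhenomena.PercolationContinuityZ3.Theorems
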